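import Literature.Probability.Percolation.SeparatingEvents
import Literature.Probability.RandomPlanarGeometry.ChordalCurveFamily
import Literature.Barriers.CriticalPhenomena.QuarterTurnResistorLaw

/-!
# Ideator-k1 sketch for crux `DyadicLatticeBetaLaw` (stmt-CriticalPhenomena-18183)

Typed pointers for the structural notes in `IdeatorK1Notes.md` (no idea card filed this round):

* `QuarterTurnCovariance` / `HalfTurnEdgeCovariance` — the two EXACT lattice covariances of
  Smirnov's bond-ℤ² separating probabilities (tree: `bondSeparatingProb`, `bondSeparatingEvent`)
  that drive every character-selection / level-one-expansion argument; the half-turn about an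
  EDGE MIDPOINT is the one that makes the level-one expansion on ℤ² rigid (note B1).
* `ExponentCeiling` — the free exponent of the crux is not free: a dyadic beta law for bond-ℤ²
  forces `a ≤ 1 − log 2 / π` (via the tree's `LongBoxHalving_holds`), note N3 for the cdisprove seat.
-/

noncomputable section

open Literature.Probability.Percolation Literature.Probability.RandomPlanarGeometry
open Literature.Probability.LatticeModels

namespace Summit.CriticalPhenomena.CardyFormulaZ2.Cruxes.DyadicLatticeBetaLaw.IdeatorK1

/-- Quarter-turn covariance of the bond-ℤ² separating probabilities at mesh points: rotating the
marked conformal triangle by `z ↦ i z` (labels unchanged) and the site with it leaves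
`H^δ_α` unchanged (exact symmetry of `P_{1/2}` on `δℤ²` and of the discretisation). -/
def QuarterTurnCovariance : Prop :=
  ∀ (T : MarkedDomain 3) (α : Fin 3) (δ : ℝ) (u : Site 2), 0 < δ →
    bondSeparatingProb (T.map (similarity Complex.I Complex.I_ne_zero 0)) α δ
        (Complex.I * meshPoint δ u) =
      bondSeparatingProb T α δ (meshPoint δ u)

/-- Half-turn covariance about the MIDPOINT of a lattice edge `uv`: the point reflection
`z ↦ c − z`, `c = meshPoint δ u + meshPoint δ v`, swaps `u` and `v`, maps `δℤ²` onto itself and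
preserves `P_{1/2}`; hence the one-sided derivative probabilities `P[E_α(v) \ E_α(u)]` in `T` and
`P[E_α(u') \ E_α(v')]` in the reflected triangle (where `u' = v`, `v' = u` as points) coincide.
Consequence (note B1): in any level-one two-scale expansion
`P[E_α(v)\E_α(u)] = δ^{2/3} π m_α(z_e) + δ ⟨β_e, ∇h⟩ + o(δ)` the polarisation vector is forced to be
purely reversal-odd, `β_e = −β_{−e} = (ê/2)·(δ_{αα'})`, i.e. the expansion carries NO free lattice
constant on ℤ². -/
def HalfTurnEdgeCovariance : Prop :=
  ∀ (T : MarkedDomain 3) (α : Fin 3) (δ : ℝ) (u v : Site 2), 0 < δ → (zdGraph 2).Adj u v →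
    (bondPercolation (zdGraph 2) half).real
        (bondSeparatingEvent (T.map (similarity (-1) (by norm_num) (meshPoint δ u + meshPoint δ v)))
            α δ (meshPoint δ u) \
          bondSeparatingEvent (T.map (similarity (-1) (by norm_num) (meshPoint δ u + meshPoint δ v)))
            α δ (meshPoint δ v)) =
      (bondPercolation (zdGraph 2) half).real
        (bondSeparatingEvent T α δ (meshPoint δ v) \ bondSeparatingEvent T α δ (meshPoint δ u))

/-- The exact "dipole identity" (trivial measure theory, the backbone of note B2):
`H_α(v) − H_α(u) = P[E_α(v) \ E_α(u)] − P[E_α(u) \ E_α(v)]`. -/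
def DipoleIdentity : Prop :=
  ∀ (T : MarkedDomain 3) (α : Fin 3) (δ : ℝ) (z w : ℂ),
    bondSeparatingProb T α δ w - bondSeparatingProb T α δ z =
      (bondPercolation (zdGraph 2) half).real
          (bondSeparatingEvent T α δ w \ bondSeparatingEvent T α δ z) -
        (bondPercolation (zdGraph 2) half).real
          (bondSeparatingEvent T α δ z \ bondSeparatingEvent T α δ w)

/-- Note N3 (for the cdisprove seat): the exponent of a dyadic beta law on bond-ℤ² is bounded above.
If the crossing probabilities of the lattice rectangles `(0,W)×(0,1)`, `W ∈ ℕ`, along meshes `2^{-k}`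
tend to `c_W` with `−log c_W / W → π (1 − a)` (the beta-law asymptotics `I_a(η_W) ≍ η_W^{1−a}`,
`η_W ≍ 16 e^{−πW}`), then `LongBoxHalving_holds` (`P ≤ 2^{−(W−1)}` uniformly in the mesh) gives
`π (1 − a) ≥ log 2`, i.e. `a ≤ 1 − log 2 / π ≈ 0.7794`. Typed here only as the arithmetic endpoint. -/
def ExponentCeiling : Prop :=
  ∀ a : ℝ, (∃ c : ℕ → ℝ, (∀ W : ℕ, 1 ≤ W → 0 < c W ∧ c W ≤ 2⁻¹ ^ (W - 1)) ∧
      Filter.Tendsto (fun W : ℕ => -Real.log (c W) / W) Filter.atTop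
        (nhds (Real.pi * (1 - a)))) →
    a ≤ 1 - Real.log 2 / Real.pi

end Summit.CriticalPhenomena.CardyFormulaZ2.Cruxes.DyadicLatticeBetaLaw.IdeatorK1

end
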